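import Summits.BirchSwinnertonDyer.BirchSwinnertonDyer.Theorems.BiquadraticEisensteinDescentEisensteinHeartFlatCMInertBadKPrimeKatzFrameBookkeeping
import Summits.BirchSwinnertonDyer.BirchSwinnertonDyer.Theorems.BiquadraticEisensteinDescentEisensteinHeartFlatCMInertBadKPrimeBranchUnramified
import Summits.BirchSwinnertonDyer.BirchSwinnertonDyer.Theorems.BiquadraticEisensteinDescentEisensteinHeartFlatCMInertBadKPrimeKatzTypeAtFrame
import Summits.BirchSwinnertonDyer.BirchSwinnertonDyer.Theorems.BiquadraticEisensteinDescentEisensteinHeartFlatCMInertBadKPrimeThetaRouteIm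
import Summits.BirchSwinnertonDyer.BirchSwinnertonDyer.Theorems.BiquadraticEisensteinDescentEisensteinHeartFlatCMInertBadKPrimeCMFieldTheta
import Summits.BirchSwinnertonDyer.BirchSwinnertonDyer.Theorems.BiquadraticEisensteinDescentEisensteinHeartFlatCMInertBadKPrimeSigmaOrientation
import Summits.BirchSwinnertonDyer.BirchSwinnertonDyer.Theorems.BiquadraticEisensteinDescentEisensteinHeartFlatCMInertBadKPrimeBiquadraticExists
import Literature.NumberTheory.EllipticCurves.KatzPAdicLFunctionCMFieldBaseChangeLineProofs
import Literature.NumberTheory.EllipticCurves.ZpExtensionRestrictProofs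
import Summits.BirchSwinnertonDyer.Rank1Residual.X12.CMIsogenyInvariance
import Literature.NumberTheory.EllipticCurves.ComplexMultiplicationMaximalOrderLeavesProofs
import Literature.NumberTheory.EllipticCurves.BSDSelmerCMPConverseMaximalOrderProofs
import Literature.NumberTheory.EllipticCurves.GlobalMinimalModelProofs
import Literature.NumberTheory.EllipticCurves.IsogenyVariableChangeProofs
import HarnessLib

set_option linter.dupNamespace false -- `Summit.BirchSwinnertonDyer.BirchSwinnertonDyer.Theorems.…` (summit = sub)
set_option autoImplicit false

/-!
# Crux `EisensteinHeartFlatCMInertBadKPrime` (stmt-BirchSwinnertonDyer-21341), line `hsieh-lambda`, skeleton v3 —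
# `stub_V2` CLOSED MODULO the two named facts (Deuring, Katz–Hida–Tilouine) and maximal CM: the TIED Katz line frame exists

Route `BiquadraticEisensteinDescent` (cell `pub/bsd-wall`, width seat `bsd-wall-cm-bed-w1`; lead `bsd-wall-cm-bed-p1`, skeleton
`Cruxes/EisensteinHeartFlatCMInertBadKPrime/Lines/hsieh_lambda.lean` v3, sha16 cc08ae1089e5f3a0, stubs `stub_hsiehWitness`,
`stub_V2`, `stub_V4K`). THEOREMS ONLY (no definition, no named fact, no `sorry`); supports stmt-BirchSwinnertonDyer-21341 as a
helper. This is a CONDITIONAL closer of the registered `stub_V2`: its statement is the registered signature with (a) the two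
published named facts `Deuring_exists_heckeCharacter_of_maximalCM` (Silverman *ATAEC* II Thm. 9.2 / 10.5) and
`hsieh2014mu_prop49_exists_isMeasure` (Katz–Hida–Tilouine, Hsieh 2014 Prop. 4.9) as hypotheses, and (b) the extra binder
`W.j ∈ maximalCMJInvariants` (CM by the MAXIMAL order — nine of the thirteen CM `j`; the four non-maximal `j` reduce to these
by the tree's `ℚ`-isogenies `exists_isIsogenous_j_mem_maximalCMJInvariants_…`, not carried out here). Nothing about the crux's
input `stub_V4K` or any case of BSD is asserted.

## The assembly (every step a landed theorem of the width seats w1–w4 and the lead)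

`L := K′(x)`, `x² = d_CM = cmFieldDiscrOfJ W.j` (`…BiquadraticExists.exists_quadratic_sqrt`; `x ∉ K′` by `CMInert` and the split
`𝔭 ≠ 𝔭′`: `…BiquadraticPrimes.not_isSquare_of_cmInert`/`not_exists_sq_eq_of_split`); `IsCMField L`, the primes `𝔓 ∣ 𝔭`, `𝔓′ ∣ 𝔭′`,
`Σ_p := {𝔓′}` a `p`-adic CM type, `p ∤ d_{L⁺}` (`…BiquadraticCMType.katz_frame_primes`); the orientation
`InSigma ι′ {𝔓′} σ ↔ σ|_{K′} = σ̄_{v₀}` (`…SigmaOrientation.inSigma_singleton_iff`, from the item's compatibility of `ι′` with `𝔭`);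
the CM field REALISED as `K₁ := ℚ⟮x⟯ ⊆ L` (`…FrameCMSubfield`: `IsCMFieldOfJ`, Galois, totally complex, `[L : ℚ⟮x⟯] = 2`, the
conjugation `c := (τ|_ℚ)|_{ℚ⟮x⟯} ≠ 1` for `τ ∈ Gal(L/K′) ∖ 1`); Deuring's `ψ` on `ℚ⟮x⟯` (named fact at `(ℚ⟮x⟯, c)`);
`λ := (ψ ∘ N_{L/ℚ⟮x⟯}) · ‖·‖_L`; (T)(C) with `w₁ ≠ w₂` (`…KatzTypeAtFrame.exists_hT_hcont_adjoin`); (L) with `c_L = c_L′ = 1`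
(`…CMFieldTheta.hLval_of_deuring_of_cmField_of_isCMFieldOfJ`, its `hψbad` from `…BranchUnramified.hψbad_of_frame`, `√d_{K′} ∈ 𝓞 K′`
from `Quadratic.exists_sq_eq_discr`, bad `ℓ ∤ d_{K′}` from `…ThetaRoute.not_dvd_discr_of_heegner`); the set `S` of places above
bad `ℓ ≠ p` (`…KatzFrameBookkeeping.exists_finset_S`), Hsieh's `ϑ` with the sets `D ⊇ S`, `T ⊆ S` and (d1), `Σ`-positivity,
`Im ≠ 0`, `hTS hTc hST hD₁–hD₄ hd2` (`…ThetaRouteIm.exists_theta_datum_route_im`, `L = K′[x]` by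
`…BranchUnramified.adjoin_eq_top_of_sq_eq`); `hS`, `hlam`, `hramS`, `hramT` (`…KatzFrameBookkeeping`, `hunr` by
`…BranchUnramified.hunr_of_frame`); `κ ∘ res` surjective with a generator `γ_L` (`ZpExtension.surjective_comp_absGaloisRestrict_of_finrank_eq_two`,
`exists_isTopGenerator_restrict`); finally the frame `(C_K, Ω, Ω′_p, G)` from `KatzCM.exists_isBaseChangeLine'` (named fact).

References: [Hsieh2014mu] Prop. 4.9 (§4.8), §1.1, §3.1, §4.1; [SilvermanATAEC1994] Ch. II Thm. 9.2, 10.5; [Katz1978] (5.3.0);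
[HidaTilouine1993] Thm. II; [Washington1997] §13.
-/

noncomputable section

open scoped Classical Topology NumberField IntermediateField
open Filter NumberField IsDedekindDomain Field PowerSeries Finset Module IntermediateField
open Literature.NumberTheory.EllipticCurves Literature.NumberTheory.GaloisRepresentations
open Literature.NumberTheory.EllipticCurves.ModularForms Literature.NumberTheory.EllipticCurves.Rank1Residual

namespace Summit.BirchSwinnertonDyer.BirchSwinnertonDyer.Theorems.BiquadraticEisensteinDescentEisensteinHeartFlatCMInertBadKPrimeStubV2

open Summit.BirchSwinnertonDyer.BirchSwinnertonDyer.Theorems.BiquadraticEisensteinDescentEisensteinHeartFlatCMInertBadKPrimeBiquadraticCMField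
open Summit.BirchSwinnertonDyer.BirchSwinnertonDyer.Theorems.BiquadraticEisensteinDescentEisensteinHeartFlatCMInertBadKPrimeBiquadraticPrimes
open Summit.BirchSwinnertonDyer.BirchSwinnertonDyer.Theorems.BiquadraticEisensteinDescentEisensteinHeartFlatCMInertBadKPrimeBiquadraticCMType
open Summit.BirchSwinnertonDyer.BirchSwinnertonDyer.Theorems.BiquadraticEisensteinDescentEisensteinHeartFlatCMInertBadKPrimeBiquadraticExists
open Summit.BirchSwinnertonDyer.BirchSwinnertonDyer.Theorems.BiquadraticEisensteinDescentEisensteinHeartFlatCMInertBadKPrimeSigmaOrientation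
open Summit.BirchSwinnertonDyer.BirchSwinnertonDyer.Theorems.BiquadraticEisensteinDescentEisensteinHeartFlatCMInertBadKPrimeFrameCMSubfield
open Summit.BirchSwinnertonDyer.BirchSwinnertonDyer.Theorems.BiquadraticEisensteinDescentEisensteinHeartFlatCMInertBadKPrimeBranchUnramified
open Summit.BirchSwinnertonDyer.BirchSwinnertonDyer.Theorems.BiquadraticEisensteinDescentEisensteinHeartFlatCMInertBadKPrimeKatzTypeAtFrame
open Summit.BirchSwinnertonDyer.BirchSwinnertonDyer.Theorems.BiquadraticEisensteinDescentEisensteinHeartFlatCMInertBadKPrimeKatzFrameBookkeeping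
open Summit.BirchSwinnertonDyer.BirchSwinnertonDyer.Theorems.BiquadraticEisensteinDescentEisensteinHeartFlatCMInertBadKPrimeThetaRoute
open Summit.BirchSwinnertonDyer.BirchSwinnertonDyer.Theorems.BiquadraticEisensteinDescentEisensteinHeartFlatCMInertBadKPrimeThetaRouteIm
open Summit.BirchSwinnertonDyer.BirchSwinnertonDyer.Theorems.BiquadraticEisensteinDescentEisensteinHeartFlatCMInertBadKPrimeTheta
open Summit.BirchSwinnertonDyer.BirchSwinnertonDyer.Theorems.BiquadraticEisensteinDescentEisensteinHeartFlatCMInertBadKPrimeCMFieldTheta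

/-- **`stub_V2` of skeleton v3, CLOSED MODULO the named facts `Deuring_exists_heckeCharacter_of_maximalCM` (Silverman *ATAEC* II
Thm. 9.2/10.5) and `hsieh2014mu_prop49_exists_isMeasure` (Katz–Hida–Tilouine, Hsieh 2014 Prop. 4.9), for maximal-order CM
(`W.j ∈ maximalCMJInvariants`, nine of the thirteen CM `j`; the other four reduce by a `ℚ`-isogeny, not done here).** For the
crux data (`W` CM, bad at `p ≥ 5` inert in `K_CM`, `K = K′` imaginary quadratic with the Heegner hypothesis, `κ` anticyclotomic with
generator `γ`, `𝔭 ≠ 𝔭′` above `p`, `f` the newform of `W`, `ι′` compatible with `𝔭`) THERE IS a TIED Katz line frame: the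
biquadratic CM field `L = K′(√d_CM)`, `Σ_p = {𝔓′}`, the bookkeeping sets `S ⊇ T`, the branch character
`λ = (ψ ∘ N_{L/ℚ⟮√d_CM⟯}) · ‖·‖_L` (`ψ` Deuring's Grössencharacter of `W` on the CM field realised as `ℚ⟮√d_CM⟯ ⊆ L`), Hsieh's `ϑ`,
periods `C_K ≠ 0`, `Ω ≠ 0`, `Ω′_p ≠ 0`, a power series `G` and places `w₁ ≠ w₂`, with: (T) Katz type `(1; n, n−1)`, (C) entire
continuation, (L) `L(λ·χ∘N, 0) = L(f/K′, χ, 1)` (`c_L = c_L′ = 1`), (R) `λ` ramified on `S ∪ {w ∣ p}` and on `Σ_p ∪ T`,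
`Im σ_w(ϑ) ≠ 0`, and `KatzCM.IsBaseChangeLine ι′ Σ_p S T κ γ λ ϑ C_K Ω Ω′_p G`. ASSEMBLY ONLY — every step is a landed theorem
of the width seats: `L` (`…BiquadraticExists`), primes/CM type (`…BiquadraticCMType.katz_frame_primes`), orientation
(`…SigmaOrientation.inSigma_singleton_iff`), `K_CM = ℚ⟮x⟯` (`…FrameCMSubfield`), (T)(C) (`…KatzTypeAtFrame`), (L)
(`…CMFieldTheta.hLval_of_deuring_of_cmField_of_isCMFieldOfJ` with `hψbad` from `…BranchUnramified.hψbad_of_frame`), `ϑ, D, T`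
(`…ThetaRouteIm.exists_theta_datum_route_im`), `S`, `hS`, `hlam`, `hramS`, `hramT` (`…KatzFrameBookkeeping`), `κ ∘ res`
(`ZpExtension.surjective_comp_absGaloisRestrict_of_finrank_eq_two`), the frame (`KatzCM.exists_isBaseChangeLine'`).
[cite: Hsieh2014mu, Prop. 4.9 (§4.8), §1.1, §3.1, §4.1] [cite: SilvermanATAEC1994, Ch. II Thm. 9.2, Thm. 10.5]
[cite: Katz1978, (5.3.0)] [cite: HidaTilouine1993, Thm. II] -/
theorem stub_V2_of_facts (hD : Deuring_exists_heckeCharacter_of_maximalCM) (hKatz : hsieh2014mu_prop49_exists_isMeasure) :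
    ∀ (W : WeierstrassCurve ℚ) [W.IsElliptic] [W.IsGloballyMinimal] (p : ℕ) [Fact p.Prime]
      [NeZero (W.conductorNorm ℤ)] (K : Type) [Field K] [NumberField K],
      W.HasCM → W.j ∈ maximalCMJInvariants → 5 ≤ p → CMInert W p → ¬ Good W p →
      IsImaginaryQuadratic K → SatisfiesHeegnerHypothesis (W.conductorNorm ℤ) K →
      4 < (NumberField.discr K).natAbs → ¬ p ∣ NumberField.classNumber K →
      ∀ (κ : ZpExtension K p), κ.IsAnticyclotomic →
        ∀ (γ : Field.absoluteGaloisGroup K) [Fact (κ.IsTopGenerator γ)]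
          (𝔭 : HeightOneSpectrum (𝓞 K)), ((p : ℕ) : 𝓞 K) ∈ 𝔭.asIdeal →
          𝔭.asIdeal.ramificationIdx (𝓞 ℚ) = 1 → 𝔭.asIdeal.inertiaDeg (𝓞 ℚ) = 1 →
          ∀ (f : CuspForm (CongruenceSubgroup.Gamma0 (W.conductorNorm ℤ)) 2), IsNewformOf W f →
            ∀ (ι' : PadicAlgCl p ≃+* ℂ),
              (∀ (w : InfinitePlace K) (k : 𝓞 K), k ∈ 𝔭.asIdeal ↔ ‖ι'.symm (w.embedding (k : K))‖ < 1) →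
                  ∀ (𝔭' : HeightOneSpectrum (𝓞 K)), ((p : ℕ) : 𝓞 K) ∈ 𝔭'.asIdeal → 𝔭' ≠ 𝔭 →
                  ∃ (L : Type) (_ : Field L) (_ : NumberField L) (_ : Algebra K L) (_ : IsGalois K L)
                    (Sp S T : Finset (HeightOneSpectrum (𝓞 L))) (lam : HeckeCharacter L) (ϑ : L) (CK : ℂ)
                    (Ω : InfinitePlace L → ℂ) (ΩpK : InfinitePlace L → ℂ_[p]) (G : PowerSeries 𝓞_ℂ_[p])
                    (w₁ w₂ : InfinitePlace L) (cL cL' : ℂ),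
                    w₁ ≠ w₂ ∧ (∀ w : InfinitePlace L, w = w₁ ∨ w = w₂) ∧
                    (∀ (χ : HeckeCharacter K) (n : ℕ), 0 < n → (∀ v : HeightOneSpectrum (𝓞 K), χ.IsUnramifiedAt v) →
                      χ.HasInfinityType (fun _ ↦ (n : ℤ)) (fun _ ↦ -(n : ℤ)) →
                      KatzCM.HasKatzType ι' Sp (lam * χ.compRelNorm L) 1 (fun w ↦ if w = w₁ then n else n - 1)) ∧
                    (∀ (χ : HeckeCharacter K) (n : ℕ), 0 < n → (∀ v : HeightOneSpectrum (𝓞 K), χ.IsUnramifiedAt v) →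
                      χ.HasInfinityType (fun _ ↦ (n : ℤ)) (fun _ ↦ -(n : ℤ)) →
                      LFunction.HasEntireContinuation (heckeLFunction (lam * χ.compRelNorm L))) ∧
                    cL ≠ 0 ∧ cL' ≠ 0 ∧
                    (∀ (χ : HeckeCharacter K) (n : ℕ), 0 < n → (∀ v : HeightOneSpectrum (𝓞 K), χ.IsUnramifiedAt v) →
                      χ.HasInfinityType (fun _ ↦ (n : ℤ)) (fun _ ↦ -(n : ℤ)) →
                      ∀ hL : LFunction.HasEntireContinuation (heckeLFunction (lam * χ.compRelNorm L)),
                        hL.continuation 0 = cL * cL' ^ n * rankinSelbergValueHecke f χ 1) ∧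
                    (∀ w ∈ S ∪ KatzCM.primesOver L p, ¬ lam.IsUnramifiedAt w) ∧
                    (∀ w ∈ Sp ∪ T, ¬ lam.IsUnramifiedAt w) ∧
                    CK ≠ 0 ∧ (∀ w, Ω w ≠ 0) ∧ (∀ w, (KatzCM.embeddingAt ι' Sp w ϑ).im ≠ 0) ∧ (∀ w, ΩpK w ≠ 0) ∧
                    KatzCM.IsBaseChangeLine ι' Sp S T κ γ lam ϑ CK Ω ΩpK G := by
  intro W _ _ p _ _ K _ _ hCM hj hp5 hCMI hbad hK hHN _ _ κ _ γ _ 𝔭 h𝔭 _ _ f hf ι' hι' 𝔭' h𝔭' hne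
  have hp : p.Prime := Fact.out
  have hp2 : p ≠ 2 := by omega
  have hp3 : 2 < p := by omega
  have hne' : 𝔭 ≠ 𝔭' := Ne.symm hne
  haveI : IsTotallyComplex K := hK.2
  haveI : IsCMField K := hK.isCMField
  -- §1 the CM discriminant `d` and the biquadratic field `L = K(x)`, `x² = d`
  set d : ℤ := cmFieldDiscrOfJ W.j with hddef
  have hd9 := cmFieldDiscrOfJ_mem_nine W hCM
  have hd0 : d < 0 := (cmDiscr_props hd9).1
  have hdeq : d = cmFieldDiscr W.j := cmFieldDiscrOfJ_eq_cmFieldDiscr hj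
  have hdns : ¬ IsSquare ((d : ℤ) : ZMod p) := not_isSquare_of_cmInert hp2 hCMI
  have hdK : ¬ ∃ y : K, y ^ 2 = (d : K) := not_exists_sq_eq_of_split hK.1 hdns h𝔭 h𝔭' hne'
  obtain ⟨L, _instF, _instN, _instA, h2, x, hx⟩ := exists_quadratic_sqrt K d hdK
  have hxK : x ∉ Set.range (algebraMap K L) := sqrt_not_mem_range hdK hx
  have hxQ : x ∉ Set.range (algebraMap ℚ L) := not_mem_range_rat hxK
  have hx' : x ^ 2 = (cmFieldDiscr W.j : L) := by rw [hx, ← hdeq]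
  have hxa : x ^ 2 = algebraMap K L (d : K) := by rw [hx, map_intCast]
  haveI : IsGalois K L := isGalois_of_finrank_eq_two h2
  haveI : IsCMField L := isCMField_of_split hK h2 hd0 hdns hx h𝔭 h𝔭' hne'
  have h4L : finrank ℚ L = 4 := finrank_eq_four hK h2
  obtain ⟨xo, hxo, hxo2⟩ :=
    Summit.BirchSwinnertonDyer.BirchSwinnertonDyer.Theorems.BiquadraticEisensteinDescentEisensteinHeartFlatCMInertBadKPrimeBiquadraticPrimes.exists_ringOfIntegers_sq_eq
      (L := L) hx
  -- §2 the primes above `p`, the `p`-adic CM type `Σ_p = {𝔓′}` and its orientation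
  obtain ⟨𝔓, 𝔓', h𝔓, h𝔓', -, -, -, -, -, hSp, -, hunrL⟩ := katz_frame_primes hK h2 hdns hx h𝔭 h𝔭' hne'
  haveI := h𝔓
  haveI := h𝔓'
  obtain ⟨v₀⟩ : Nonempty (InfinitePlace K) := inferInstance
  have hSig : ∀ σ : L →+* ℂ, KatzCM.InSigma ι' ({𝔓'} : Finset (HeightOneSpectrum (𝓞 L))) σ ↔
      σ.comp (algebraMap K L) = ComplexEmbedding.conjugate v₀.embedding :=
    fun σ ↦ inSigma_singleton_iff hK h4L hdns hxo2 h𝔭 h𝔭' hne' (𝔓 := 𝔓) (𝔓' := 𝔓') (hι' v₀) σ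
  -- §3 the CM field realised as `K₁ = ℚ⟮x⟯ ⊆ L`, the conjugation `c`, Deuring's `ψ`, the branch character `λ`
  have hK₁ : IsCMFieldOfJ ℚ⟮x⟯ W.j := isCMFieldOfJ_adjoin hx' hxQ
  haveI : IsGalois ℚ⟮x⟯ L := isGalois_adjoin_top hK h2 hx hxQ
  haveI : IsGalois ℚ ℚ⟮x⟯ := isGalois_adjoin hx hxQ
  haveI : IsTotallyComplex ℚ⟮x⟯ := isTotallyComplex_adjoin hx hd0
  have h2L₁ : finrank ℚ⟮x⟯ L = 2 := finrank_adjoin_top_eq_two hK h2 hx hxQ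
  obtain ⟨τ, hτ⟩ := exists_ne_one (K := K) (L := L) h2
  have hc : (τ.restrictScalars ℚ).restrictNormal ℚ⟮x⟯ ≠ 1 := restrictNormal_ne_one h2 hx hxK τ hτ
  obtain ⟨ψ, hψ1, -, hψiii, hψiv, -⟩ := hD W hj ℚ⟮x⟯ hK₁ _ hc
  set lam : HeckeCharacter L := ψ.compRelNorm L * HeckeCharacter.normCharacter L with hlam
  -- §4 (T) and (C)
  obtain ⟨w₁, w₂, hw, huniv, hT, hcont⟩ := exists_hT_hcont_adjoin hK h2 hx hd0 hxK hSp hSig hψ1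
  -- §5 (L): Deuring over `K′` at the frame, `hψbad` from the frame, `c_L = c_L′ = 1`
  obtain ⟨-, -, δ, -, hδ⟩ := Literature.NumberTheory.QuadraticFields.Quadratic.exists_sq_eq_discr (K := K) hK.1
  have hδ' : δ ^ 2 = (NumberField.discr K : 𝓞 K) := by rw [hδ]
  have hbadK : ∀ (ℓ : ℕ) [Fact ℓ.Prime], ¬ W.HasGoodReductionAtPrime ℓ → ¬ (ℓ : ℤ) ∣ NumberField.discr K :=
    fun ℓ _ hb ↦ not_dvd_discr_of_heegner hK hHN (Fact.out)
      ((W.dvd_conductorNorm_iff_not_hasGoodReductionAtPrime ℓ).mpr hb)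
  have hψbad := hψbad_of_frame hK h2 W hj hx' hxK hδ' hbadK hψiii
  have hν : ∀ y : ideleGroup L, ((HeckeCharacter.normCharacter L y : ℂˣ) : ℂ) = ((ideleNorm y : ℝ) : ℂ) ^ (1 : ℂ) :=
    fun y ↦ by rw [Complex.cpow_one, HeckeCharacter.normCharacter_apply]
  have hLval := hLval_of_deuring_of_cmField_of_isCMFieldOfJ hSp W hCM hj hK₁ hc hψ1 hψiv hψbad hf hK.1 h2 h2L₁ hτ rfl
    hν hT
  -- §6 the bookkeeping sets: `S` (primes above bad `ℓ ≠ p`), Hsieh's `ϑ`, `D`, `T`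
  obtain ⟨S, hSmem⟩ := exists_finset_S (L := L) W p
  have hgen : Algebra.adjoin K {x} = ⊤ := adjoin_eq_top_of_sq_eq h2 hxa hxK
  have hSP : ∀ w ∈ S, ∃ ℓ ∈ (W.conductorNorm ℤ).primeFactors, ((ℓ : ℕ) : 𝓞 L) ∈ w.asIdeal := by
    intro w hw
    obtain ⟨ℓ, hℓ, hℓw, hℓbad⟩ := exists_prime_mem_of_mem_D W p hSmem (Finset.mem_union_right _ hw)
    refine ⟨ℓ, Nat.mem_primeFactors.mpr ⟨hℓ.out, ?_, NeZero.ne _⟩, hℓw⟩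
    rcases hℓbad with rfl | hℓbad
    · exact (W.dvd_conductorNorm_iff_not_hasGoodReductionAtPrime ℓ).mpr hbad
    · exact (W.dvd_conductorNorm_iff_not_hasGoodReductionAtPrime ℓ).mpr hℓbad
  obtain ⟨ϑ, D, T, hϑ₁, hϑ₂, hIm', hTS, hTc, hST, hD₁, hD₂, hD₃, hD₄, hd2⟩ :=
    exists_theta_datum_route_im W p K hCM hbad hK hHN L h2.le hgen hx v₀.embedding (fun σ h ↦ (hSig σ).mp h) S hSP
  -- §7 the ramification profile of `λ` and `hS`
  have hS := hS_of_mem W p hSmem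
  have hlamS := hlam_of_mem p hSmem hj hK₁ hψiii
  have hunr := hunr_of_frame hK h2 hx' hxK hδ' W hbadK
  have hramS := hramS_of_mem p hSmem hj hK₁ hψiii hbad hunr
  have hramT := hramT_of_mem p hSmem hj hK₁ hψiii hbad hunr hSp.1 hTS
  -- §8 the restricted `ℤ_p`-extension and the Katz frame
  have hs := ZpExtension.surjective_comp_absGaloisRestrict_of_finrank_eq_two hp2 κ L h2
  obtain ⟨γL, hγL⟩ := ZpExtension.exists_isTopGenerator_restrict κ L hs
  have hγ : κ.IsTopGenerator γ := Fact.out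
  obtain ⟨CK, Ω, ΩpK, G, hCK, hΩ, hΩpK, hG⟩ :=
    KatzCM.exists_isBaseChangeLine' (ι := ι') (lam := lam) hKatz hp3 hunrL hSp hϑ₁ hϑ₂ hS hTS hTc hST hD₁ hD₂ hD₃ hD₄ hd2
      hlamS hs hγ hγL
  have hΩpK0 : ∀ w, ΩpK w ≠ 0 := fun w h ↦ by
    have h1 := hΩpK w
    rw [h, norm_zero] at h1
    exact zero_ne_one h1
  exact ⟨L, _instF, _instN, _instA, inferInstance, {𝔓'}, S, T, lam, ϑ, CK, Ω, ΩpK, G, w₁, w₂, 1, 1, hw, huniv, hT, hcont,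
    one_ne_zero, one_ne_zero, hLval, hramS, hramT, hCK, hΩ, fun w ↦ hIm' _, hΩpK0, hG⟩

/-! ### Appended: all thirteen CM `j` — the maximal-order binder removed by a `ℚ`-isogeny (one more print binder: Carayol) -/

/-- Transport of a cusp form along an equality of levels (`N = N′`): the "same" form at level `N′`, with the same newform
property and the same Rankin–Selberg values. [folklore] -/
theorem exists_cuspForm_of_level_eq {N N' : ℕ} (h : N = N') [NeZero N] [NeZero N'] (f : CuspForm (CongruenceSubgroup.Gamma0 N) 2)
    (K : Type) [Field K] [NumberField K] :
    ∃ f' : CuspForm (CongruenceSubgroup.Gamma0 N') 2, (∀ (V : WeierstrassCurve ℚ), IsNewformOf V f → IsNewformOf V f') ∧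
      ∀ (χ : HeckeCharacter K) (s : ℂ), rankinSelbergValueHecke f' χ s = rankinSelbergValueHecke f χ s := by
  subst h
  exact ⟨f, fun _ hV ↦ hV, fun _ _ ↦ rfl⟩

/-- **`stub_V2` for ALL CM curves, CLOSED MODULO three named facts**: the registered `stub_V2` signature VERBATIM, granted
Deuring (`Deuring_exists_heckeCharacter_of_maximalCM`), Katz–Hida–Tilouine (`hsieh2014mu_prop49_exists_isMeasure`) and Carayol's
«level of the newform = conductor» (`IsNewformOf.level_eq_conductorNorm`, used only to retype `f` at the level of the isogenous
maximal-order model). Reduction to `stub_V2_of_facts`: a CM curve `W/ℚ` is `ℚ`-isogenous to one with `j ∈ maximalCMJInvariants`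
(`exists_isIsogenous_j_mem_maximalCMJInvariants_of_j_mem_cmJInvariants`, the four explicit isogenies of Silverman *ATAEC* App. A §3,
PROVED in the tree, with `hasCM_iff_j_mem_holds`), replaced by a global minimal model (`hasGlobalMinimalModel_rat_holds`); CM, the
CM type at `p`, good reduction and the newform are isogeny invariants (`X12.hasCM_iff_of_isIsogenous`, `X12.cmInert_iff_of_isIsogenous`,
`IsIsogenous.hasGoodReductionAtPrime_iff`, `IsIsogenous.LFunction_eq`), and the conclusion of `stub_V2` mentions `W` only through `f`.
[cite: SilvermanATAEC1994, App. A §3 and Ch. II Exercise 2.12 (b)] [cite: Carayol1986] [cite: Hsieh2014mu, Prop. 4.9 (§4.8)] -/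
theorem stub_V2_of_facts_all (hD : Deuring_exists_heckeCharacter_of_maximalCM) (hKatz : hsieh2014mu_prop49_exists_isMeasure)
    (hlevel : ∀ (N : ℕ) [NeZero N], IsNewformOf.level_eq_conductorNorm (N := N)) :
    ∀ (W : WeierstrassCurve ℚ) [W.IsElliptic] [W.IsGloballyMinimal] (p : ℕ) [Fact p.Prime]
      [NeZero (W.conductorNorm ℤ)] (K : Type) [Field K] [NumberField K],
      W.HasCM → 5 ≤ p → CMInert W p → ¬ Good W p →
      IsImaginaryQuadratic K → SatisfiesHeegnerHypothesis (W.conductorNorm ℤ) K →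
      4 < (NumberField.discr K).natAbs → ¬ p ∣ NumberField.classNumber K →
      ∀ (κ : ZpExtension K p), κ.IsAnticyclotomic →
        ∀ (γ : Field.absoluteGaloisGroup K) [Fact (κ.IsTopGenerator γ)]
          (𝔭 : HeightOneSpectrum (𝓞 K)), ((p : ℕ) : 𝓞 K) ∈ 𝔭.asIdeal →
          𝔭.asIdeal.ramificationIdx (𝓞 ℚ) = 1 → 𝔭.asIdeal.inertiaDeg (𝓞 ℚ) = 1 →
          ∀ (f : CuspForm (CongruenceSubgroup.Gamma0 (W.conductorNorm ℤ)) 2), IsNewformOf W f →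
            ∀ (ι' : PadicAlgCl p ≃+* ℂ),
              (∀ (w : InfinitePlace K) (k : 𝓞 K), k ∈ 𝔭.asIdeal ↔ ‖ι'.symm (w.embedding (k : K))‖ < 1) →
                  ∀ (𝔭' : HeightOneSpectrum (𝓞 K)), ((p : ℕ) : 𝓞 K) ∈ 𝔭'.asIdeal → 𝔭' ≠ 𝔭 →
                  ∃ (L : Type) (_ : Field L) (_ : NumberField L) (_ : Algebra K L) (_ : IsGalois K L)
                    (Sp S T : Finset (HeightOneSpectrum (𝓞 L))) (lam : HeckeCharacter L) (ϑ : L) (CK : ℂ)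
                    (Ω : InfinitePlace L → ℂ) (ΩpK : InfinitePlace L → ℂ_[p]) (G : PowerSeries 𝓞_ℂ_[p])
                    (w₁ w₂ : InfinitePlace L) (cL cL' : ℂ),
                    w₁ ≠ w₂ ∧ (∀ w : InfinitePlace L, w = w₁ ∨ w = w₂) ∧
                    (∀ (χ : HeckeCharacter K) (n : ℕ), 0 < n → (∀ v : HeightOneSpectrum (𝓞 K), χ.IsUnramifiedAt v) →
                      χ.HasInfinityType (fun _ ↦ (n : ℤ)) (fun _ ↦ -(n : ℤ)) →
                      KatzCM.HasKatzType ι' Sp (lam * χ.compRelNorm L) 1 (fun w ↦ if w = w₁ then n else n - 1)) ∧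
                    (∀ (χ : HeckeCharacter K) (n : ℕ), 0 < n → (∀ v : HeightOneSpectrum (𝓞 K), χ.IsUnramifiedAt v) →
                      χ.HasInfinityType (fun _ ↦ (n : ℤ)) (fun _ ↦ -(n : ℤ)) →
                      LFunction.HasEntireContinuation (heckeLFunction (lam * χ.compRelNorm L))) ∧
                    cL ≠ 0 ∧ cL' ≠ 0 ∧
                    (∀ (χ : HeckeCharacter K) (n : ℕ), 0 < n → (∀ v : HeightOneSpectrum (𝓞 K), χ.IsUnramifiedAt v) →
                      χ.HasInfinityType (fun _ ↦ (n : ℤ)) (fun _ ↦ -(n : ℤ)) →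
                      ∀ hL : LFunction.HasEntireContinuation (heckeLFunction (lam * χ.compRelNorm L)),
                        hL.continuation 0 = cL * cL' ^ n * rankinSelbergValueHecke f χ 1) ∧
                    (∀ w ∈ S ∪ KatzCM.primesOver L p, ¬ lam.IsUnramifiedAt w) ∧
                    (∀ w ∈ Sp ∪ T, ¬ lam.IsUnramifiedAt w) ∧
                    CK ≠ 0 ∧ (∀ w, Ω w ≠ 0) ∧ (∀ w, (KatzCM.embeddingAt ι' Sp w ϑ).im ≠ 0) ∧ (∀ w, ΩpK w ≠ 0) ∧
                    KatzCM.IsBaseChangeLine ι' Sp S T κ γ lam ϑ CK Ω ΩpK G := by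
  intro W _ _ p _ _ K _ _ hCM hp5 hCMI hbad hK hHN h4 hcl κ hκ γ _ 𝔭 h𝔭 he𝔭 hf𝔭 f hf ι' hι' 𝔭' h𝔭' hne
  -- an isogenous globally minimal curve with CM by the maximal order
  obtain ⟨W₁, _, hiso₁, hj₁⟩ := exists_isIsogenous_j_mem_maximalCMJInvariants_of_j_mem_cmJInvariants W
    ((WeierstrassCurve.hasCM_iff_j_mem_holds W).mp hCM)
  obtain ⟨C, hC⟩ := WeierstrassCurve.hasGlobalMinimalModel_rat_holds W₁
  haveI := hC
  have hiso : WeierstrassCurve.IsIsogenous W (C • W₁) := hiso₁.trans' (WeierstrassCurve.isIsogenous_smul W₁ C)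
  have hj' : (C • W₁).j ∈ maximalCMJInvariants := by rw [WeierstrassCurve.variableChange_j]; exact hj₁
  have hCM' : (C • W₁).HasCM := (Summit.BirchSwinnertonDyer.Rank1Residual.X12.hasCM_iff_of_isIsogenous hiso).mp hCM
  have hCMI' : CMInert (C • W₁) p :=
    (Summit.BirchSwinnertonDyer.Rank1Residual.X12.cmInert_iff_of_isIsogenous hiso hCM p).mp hCMI
  have hbad' : ¬ Good (C • W₁) p := fun h ↦ hbad ((hiso.hasGoodReductionAtPrime_iff p).mpr h)
  haveI : NeZero ((C • W₁).conductorNorm ℤ) := ⟨((C • W₁).conductorNorm_pos_holds).ne'⟩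
  have hf₁ : IsNewformOf (C • W₁) f := ⟨hf.1, fun n ↦ by rw [hf.2 n, hiso.LFunction_eq]⟩
  have hN : W.conductorNorm ℤ = (C • W₁).conductorNorm ℤ := hlevel (W.conductorNorm ℤ) hf₁
  obtain ⟨f', hff', hRS⟩ := exists_cuspForm_of_level_eq hN f K
  have hHN' : SatisfiesHeegnerHypothesis ((C • W₁).conductorNorm ℤ) K := hN ▸ hHN
  obtain ⟨L, i₁, i₂, i₃, i₄, Sp, S, T, lam, ϑ, CK, Ω, ΩpK, G, w₁, w₂, cL, cL', hw, huniv, hT, hcont, hcL, hcL', hLval, hramS,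
      hramT, hCK, hΩ, hIm, hΩpK, hG⟩ :=
    stub_V2_of_facts hD hKatz (C • W₁) p K hCM' hj' hp5 hCMI' hbad' hK hHN' h4 hcl κ hκ γ 𝔭 h𝔭 he𝔭 hf𝔭 f' (hff' _ hf₁) ι' hι'
      𝔭' h𝔭' hne
  refine ⟨L, i₁, i₂, i₃, i₄, Sp, S, T, lam, ϑ, CK, Ω, ΩpK, G, w₁, w₂, cL, cL', hw, huniv, hT, hcont, hcL, hcL', ?_, hramS, hramT,
    hCK, hΩ, hIm, hΩpK, hG⟩
  intro χ n hn hu hχ hL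
  rw [← hRS χ 1]
  exact hLval χ n hn hu hχ hL

end Summit.BirchSwinnertonDyer.BirchSwinnertonDyer.Theorems.BiquadraticEisensteinDescentEisensteinHeartFlatCMInertBadKPrimeStubV2

end
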